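import Summits.BirchSwinnertonDyer.BirchSwinnertonDyer.Theorems.RamifiedHeegnerPairTwistUnitInertZero
import HarnessLib

/-!
# U₀ at the two-SPLIT-carrier Gss2 classes (rank zero; the Shimura rows), TU₀|inert — part K: `334170br1`, `336114l1`

Continuation of `…Theorems.RamifiedHeegnerPairTwistUnitInertZero` (seat `bsd-trib-w-rhp` g14; the two rank-zero doors
`leafRankZeroUpper_three_of_twoCarriers_of_sqrtField` / `leafRankZeroUpper_three_of_twoInert_twoOutside_of_sqrtField` and the full framing are there; the generic
kernel lemmas are in `…TwistUnitInert`): per rank-zero curve `subGss_three_<label>` (Addv ∧ SubGss at `3` in the kernel), `Δ_eq_/c₄_eq_/krausList_<label>`, Kraus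
minimality of `V = E^{(-3)}_min` and of the twist model `Wd`, and `u0_at_<label> : … → MissingUpperBoundAt W 3` by rhp-p2 g10's certificate shape p662479
`LeafShimuraInert.leafRankZeroUpper_three_of_shimuraInertDatum_of_twistUnitZero` with the six printed facts `hGZK hmod hnf hJL hCO hHK` as hypotheses, the split / no-split / Tate
certificates, `hothers`, `hshape` and the field congruences IN THE KERNEL, and `hN hr Dt hc` + `L(E^D,1) = 0 ≠ L′(E^D,1)` + `#Ш(Wd)_an` DISPLAYED (census kit j318499:
rank-one-twist certificates `X = L′·T²/(Ω·∏c·ĥ)` at a saturated point).  **HONEST FRAMING: theorems only; nothing is booked, no item is closed; U₀ (26024) /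
TU₀|inert / the Shimura-curve Gross–Zagier–Kolyvagin inputs stay research-level and OPEN class-wide; BSD is NOT proved for any curve by this file.**
[cite: JetchevSkinnerWan2017, §7.4.2 (p. 31), Thm. 4.4.1 (p. 19)] [cite: PastenShimura2024, Prop. 6.13, Lemma 6.16, Lemma 6.18 (pp. 23–24)]
[cite: PapikianRabinoff2016, Cor. 3.5] [cite: SilvermanAEC2009, VII.5 Prop. 5.1] [cite: SilvermanATAEC1994, IV.9.4] [cite: Tate1975, §7] [cite: Kraus1989, Prop. 1]
[cite: Marcus2018, Ch. 3 Thm. 25] [cite: Miller2011LMS, Def. 1.1] [cite: Cremona2006, Table 1]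
-/

set_option linter.dupNamespace false
set_option autoImplicit false

noncomputable section

open scoped Classical NumberField

open WeierstrassCurve NumberField IsDedekindDomain IsDedekindDomain.HeightOneSpectrum Rat.HeightOneSpectrum Field Literature Literature.NumberTheory.DiophantineGeometry
  Literature.NumberTheory.EllipticCurves Literature.NumberTheory.EllipticCurves.ModularForms Literature.NumberTheory.EllipticCurves.Rank1Residual
  Literature.NumberTheory.EllipticCurves.Rank1Residual.Typed Literature.NumberTheory.Automorphic Literature.NumberTheory.EllipticCurves.Rank1Residual.X11RankOneCertificates
  Literature.NumberTheory.EllipticCurves.KrizLi2019 Literature.NumberTheory.GaloisRepresentations Literature.NumberTheory.QuadraticFields Literature.NumberTheory.QuadraticFields.Quadratic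
  Summit.BirchSwinnertonDyer.BirchSwinnertonDyer.Rank1Residual Summit.BirchSwinnertonDyer.BirchSwinnertonDyer.Rank1Residual.IntModel
  Summit.BirchSwinnertonDyer.BirchSwinnertonDyer.Rank2Observatory.Tam Summit.BirchSwinnertonDyer.Rank1Residual Summit.BirchSwinnertonDyer.Rank1Residual.Additive
  Summit.BirchSwinnertonDyer.Rank1Residual.X11b Summit.BirchSwinnertonDyer.Rank1Residual.X11b.Three Summit.BirchSwinnertonDyer.Rank1Residual.X9 Summit.BirchSwinnertonDyer.Rank1Residual.GaloisImage
  Summit.BirchSwinnertonDyer.Rank1Residual.Supersingular Summit.BirchSwinnertonDyer.BirchSwinnertonDyer.Theses.RamifiedHeegnerPair Summit.BirchSwinnertonDyer.BirchSwinnertonDyer.Theorems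
  Summit.BirchSwinnertonDyer.BirchSwinnertonDyer.Theorems.SchneiderFree Summit.BirchSwinnertonDyer.BirchSwinnertonDyer.Theorems.RamifiedPairUpperBound
  Summit.BirchSwinnertonDyer.BirchSwinnertonDyer.Theorems.RamifiedHeegnerPairStepLIntrinsic Summit.BirchSwinnertonDyer.BirchSwinnertonDyer.Theorems.AdditiveBranchIMCGordTwoRankOne.HeegnerKolyvagin
  Summit.BirchSwinnertonDyer.BirchSwinnertonDyer.Theorems.RamifiedHeegnerPairTwistUnitIntrinsic Summit.BirchSwinnertonDyer.BirchSwinnertonDyer.Theorems.RamifiedHeegnerPairTwistUnitAdditive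

namespace Summit.BirchSwinnertonDyer.BirchSwinnertonDyer.Theorems.RamifiedHeegnerPairTwistUnitInertZero

open RamifiedHeegnerPairTwistUnitInert

/-! ## §19 `334170br1` = `[1, -1, 1, -196922, -33585479]`, `N = 334170 = 2·3^2·5·47·79` (`2`: I6, `c = 6`, split, `3`: I₀*, `c = 1`, `5`: I3, `c = 3`, split, `47`: I1, `c = 1`, non-split, `79`: I2, `c = 2`, non-split); carriers `S = {2, 5}` (split, `3 ∣ ord Δ`), (DEG) by Papikian–Rabinoff at `q₂ = 5` (odd, `≡ 2 (mod 3)`);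
`r_an = 0`, `#E(ℚ)_tors = 1`, `∏ c_ℓ = 36`, `#Ш(E)_an = 1` (Cremona/LMFDB, displayed where used); class `334170br` of size 1.
`V = E^{(-3)}_min = [1, -1, 0, -21880, 1251200]` (`#Ṽ(𝔽₃) = 1`).  JSW field `K = ℚ(√-107)` (`107` prime; `2`, `5` inert, every other `ℓ ∣ N` split): the least such `D` (among those tried) with a CERTIFIED twist unit
(kit j318499: root no. `−1`, `L′(Wd,1) = 10.284330`, `Wd = E^{(-107)}_min = [1, -1, 0, -2254556400, 41204528648000]`, `N(Wd) = 3825912330`, `∏c = 8`, `T = 1`, point by `ellrank(effort=0)`, eclib-full saturation (index 1), `ĥ = 18.417237`,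
`X = L′T²/(Ω∏c ĥ) = 1` to `0e+00` — the numerical `#Ш(Wd)_an` given rank `1`). -/

/-- `V = [1, -1, 0, -21880, 1251200]` (the minimal model of `334170br1^{(-3)}`, conductor `37130`): `Δ ≠ 0` in the kernel. [cite: Cremona2006, Table 1 (Cremona label 334170br1)] -/
theorem isElliptic_sV334170br1 : (⟨1, -1, 0, -21880, 1251200⟩ : WeierstrassCurve ℚ).IsElliptic :=
  isElliptic_of_discOf_ne_zero 1 (-1) 0 (-21880) 1251200 (by decide +kernel)

/-- `V` is globally minimal: `|Δ| = 2^6·5^3·47·79^2` kernel-checked, Kraus' criterion prime by prime. [cite: Kraus1989, Prop. 1 and Prop. 2]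
[cite: SilvermanAEC2009, VII.1 Remark 1.1] [cite: Cremona2006, Table 1 (Cremona label 334170br1)] -/
theorem isGloballyMinimal_sV334170br1 : (⟨1, -1, 0, -21880, 1251200⟩ : WeierstrassCurve ℚ).IsGloballyMinimal :=
  isGloballyMinimal_of_krausCriterion₃_factored 1 (-1) 0 (-21880) 1251200
    [(2, 6), (5, 3), (47, 1), (79, 2)] (by decide +kernel)
    (by intro qe hqe; simp only [List.mem_cons, List.not_mem_nil, or_false] at hqe
        rcases hqe with rfl | rfl | rfl | rfl <;> norm_num)
    (by set_option synthInstance.maxSize 2000 in decide +kernel)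

/-- `Wd = [1, -1, 0, -2254556400, 41204528648000]` (the minimal model of the twist `334170br1^{(-107)}`, conductor `3825912330`): `Δ ≠ 0` in the kernel. [cite: Cremona2006, Table 1 (Cremona label 334170br1)] -/
theorem isElliptic_sWd334170br1 : (⟨1, -1, 0, -2254556400, 41204528648000⟩ : WeierstrassCurve ℚ).IsElliptic :=
  isElliptic_of_discOf_ne_zero 1 (-1) 0 (-2254556400) 41204528648000 (by decide +kernel)

/-- `Wd` is globally minimal: `|Δ| = 2^6·3^6·5^3·47·79^2·107^6` kernel-checked, Kraus' criterion prime by prime. [cite: Kraus1989, Prop. 1 and Prop. 2]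
[cite: SilvermanAEC2009, VII.1 Remark 1.1] [cite: Cremona2006, Table 1 (Cremona label 334170br1)] -/
theorem isGloballyMinimal_sWd334170br1 : (⟨1, -1, 0, -2254556400, 41204528648000⟩ : WeierstrassCurve ℚ).IsGloballyMinimal :=
  isGloballyMinimal_of_krausCriterion₃_factored 1 (-1) 0 (-2254556400) 41204528648000
    [(2, 6), (3, 6), (5, 3), (47, 1), (79, 2), (107, 6)] (by decide +kernel)
    (by intro qe hqe; simp only [List.mem_cons, List.not_mem_nil, or_false] at hqe
        rcases hqe with rfl | rfl | rfl | rfl | rfl | rfl <;> norm_num)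
    (by set_option synthInstance.maxSize 2000 in decide +kernel)

/-- **`334170br1` is ADDITIVE at `3` and on the cell (G) ∧ ss, IN THE KERNEL**: `3 ∣ Δ`, `3 ∣ c₄`; `C • V^{(-3)} = E` (`[u, r, s, t] = [1, -1, 1/2, 1/2]`) with
`V` globally minimal, `3 ∤ Δ(V)`, `#Ṽ(𝔽₃) = 1` (`a₃(V) = 3`, supersingular), whence `TypeG`, `SubGord`, `SubGss` at `3` (g13's block, unchanged).
[cite: SilvermanAEC2009, VII.5 Prop. 5.1 (a), (c)] [cite: Delbourgo1998, §1.5 (G)] [cite: Cremona2006, Table 1 (Cremona label 334170br1)] -/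
theorem subGss_three_334170br1 {W : WeierstrassCurve ℚ} [W.IsElliptic] [W.IsGloballyMinimal] (hWeq : W = (⟨1, -1, 1, -196922, -33585479⟩ : WeierstrassCurve ℚ)) :
    Addv W 3 ∧ SubGss W 3 := by
  subst hWeq
  haveI := isElliptic_sV334170br1
  haveI := isGloballyMinimal_sV334170br1
  have hIW : integralModelInt (⟨1, -1, 1, -196922, -33585479⟩ : WeierstrassCurve ℚ) = (⟨1, -1, 1, -196922, -33585479⟩ : WeierstrassCurve ℤ) :=
    integralModelInt_eq_of_map_eq _ (map_mk_int 1 (-1) 1 (-196922) (-33585479))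
  have hadd : Addv (⟨1, -1, 1, -196922, -33585479⟩ : WeierstrassCurve ℚ) 3 := Additive.addv_of_intModel hIW 3 (by decide +kernel) (by decide +kernel)
  have hIV : integralModelInt (⟨1, -1, 0, -21880, 1251200⟩ : WeierstrassCurve ℚ) = (⟨1, -1, 0, -21880, 1251200⟩ : WeierstrassCurve ℤ) :=
    integralModelInt_eq_of_map_eq _ (map_mk_int 1 (-1) 0 (-21880) 1251200)
  have hcV : Nat.card ((((⟨1, -1, 0, -21880, 1251200⟩ : WeierstrassCurve ℤ)).map (Int.castRingHom (ZMod 3))).toAffine.Point) = 1 := by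
    have h := natCard_point_eq_countPoints 1 (-1) 0 (-21880) 1251200 3 (by norm_num) (by decide +kernel)
    have h' : countPoints [1, -1, 0, -21880, 1251200] 3 = 1 := countPoints_eq_of_fast (by decide +kernel)
    exact_mod_cast h.trans h'
  have hgood : GoodSS (⟨1, -1, 0, -21880, 1251200⟩ : WeierstrassCurve ℚ) 3 := Supersingular.goodSS_of_intModel 3 hIV (by decide +kernel) hcV (by decide)
  have hVW : (⟨1, (-1 : ℚ), ((1:ℚ)/2), ((1:ℚ)/2)⟩ : VariableChange ℚ) • (⟨1, -1, 0, -21880, 1251200⟩ : WeierstrassCurve ℚ).quadraticTwist (-3) =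
      (⟨1, -1, 1, -196922, -33585479⟩ : WeierstrassCurve ℚ) := by
    ext <;> simp [WeierstrassCurve.variableChange_a₁, WeierstrassCurve.variableChange_a₂,
      WeierstrassCurve.variableChange_a₃, WeierstrassCurve.variableChange_a₄, WeierstrassCurve.variableChange_a₆,
      WeierstrassCurve.quadraticTwist, WeierstrassCurve.b₂, WeierstrassCurve.b₄, WeierstrassCurve.b₆] <;> norm_num
  obtain ⟨C, hC⟩ := exists_variableChange_quadraticTwist_symm (⟨1, -1, 1, -196922, -33585479⟩ : WeierstrassCurve ℚ)
    (⟨1, -1, 0, -21880, 1251200⟩ : WeierstrassCurve ℚ) (d := (-3 : ℚ)) (by norm_num) ⟨_, hVW⟩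
  have hC' : C • (⟨1, -1, 1, -196922, -33585479⟩ : WeierstrassCurve ℚ).quadraticTwist ((-1 : ℚ) ^ ((3 : ℕ) / 2) * (3 : ℕ)) =
      (⟨1, -1, 0, -21880, 1251200⟩ : WeierstrassCurve ℚ) := by
    rw [O5.pstar_three]; exact hC
  have hG : TypeG (⟨1, -1, 1, -196922, -33585479⟩ : WeierstrassCurve ℚ) 3 := (typeG_three_iff_good_twist _ hadd _ C hC').mpr hgood.1
  exact ⟨hadd, (O5.subGss_three_iff_subGord_and_goodSS_twist _ hadd _ C hC).mpr
    ⟨subGord_three_of_typeG_of_addv _ hG hadd, hgood⟩⟩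

/-- `Δ(E₀) = 1710683064000 = 2^6·3^6·5^3·47·79^2` on the integer equation of `334170br1`. [cite: Cremona2006, Table 1 (Cremona label 334170br1)] -/
theorem Δ_eq_334170br1 : (⟨1, -1, 1, -196922, -33585479⟩ : WeierstrassCurve ℤ).Δ = 1710683064000 := by
  norm_num [WeierstrassCurve.Δ, WeierstrassCurve.b₂, WeierstrassCurve.b₄, WeierstrassCurve.b₆, WeierstrassCurve.b₈]

/-- `c₄(E₀) = 9452241` on the integer equation of `334170br1`. [cite: Cremona2006, Table 1 (Cremona label 334170br1)] -/
theorem c₄_eq_334170br1 : (⟨1, -1, 1, -196922, -33585479⟩ : WeierstrassCurve ℤ).c₄ = 9452241 := by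
  norm_num [WeierstrassCurve.c₄, WeierstrassCurve.b₂, WeierstrassCurve.b₄]

/-- The Kraus list of `334170br1` consists of primes and multiplies to `|Δ(E₀)|`, IN THE KERNEL: a prime dividing `Δ_min` is one of `[2, 3, 5, 47, 79]`. [cite: Cremona2006, Table 1 (Cremona label 334170br1)] -/
theorem krausList_334170br1 : (∀ qe ∈ ([(2, 6), (3, 6), (5, 3), (47, 1), (79, 2)] : List (ℕ × ℕ)), qe.1.Prime) ∧
    (([(2, 6), (3, 6), (5, 3), (47, 1), (79, 2)] : List (ℕ × ℕ)).map fun qe => qe.1 ^ qe.2).prod = (1710683064000 : ℤ).natAbs :=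
  ⟨by decide +kernel, by decide +kernel⟩

/-- **U₀ AT `334170br1` BY THE INERT-CARRIER (Shimura-curve) ROAD, TU₀|inert** — `MissingUpperBoundAt W 3` at `W = E` (`r_an = 0`) from rhp-p2 g10's certificate shape
p662479 `leafRankZeroUpper_three_of_shimuraInertDatum_of_twistUnitZero` (Papikian–Rabinoff (DEG) at the odd carrier) through the §0 door `leafRankOneUpper_three_of_twoCarriers_of_sqrtField` of part one.  PRINTED: `hGZK hmod hnf hJL hCO hHK`.  KERNEL: `Addv ∧ SubGss` at `3`;
`2`, `5` split (nodal roots `0`, `1`); every prime of `Δ_min` enumerated (`krausList_334170br1`) for `hothers` and `hshape` (`c = 1` off `Δ_min`, Kodaira–Néron at the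
multiplicative primes, Tate certificates at the additive primes `[3]`); the congruences making `2`, `5` inert and the other `ℓ ∣ N` split in `ℚ(√-107)`; the twist
identity `Cd • E^{(-107)} = Wd`, `Cd = [1, -27, 1/2, 0]`, with `Wd` Kraus-minimal.  DISPLAYED: `hN`, `hr` (`r_an = 0`), `Dt`/`hc` (`3 ∤ c(Dt)`), `hLt0`/`hLt1` (`L(E^{(-107)},1) = 0 ≠ L′(E^{(-107)},1)`; census: root number `−1`, `L′(Wd,1) ≈ 10.284330`),
`hqd`/`hvd` (`#Ш(Wd)_an = 1`; census: `X = L′·T²/(Ω·∏c·ĥ(P)) = 1` to `0.0e+00` at the eclib-full-saturated point `P` of height `18.417237` found by `ellrank(effort=0)`).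
NO ¬CM / S2 / Σ / L₀ / L₁.  Per curve; U₀ (26024) stays OPEN class-wide; BSD is NOT proved by this.
[cite: JetchevSkinnerWan2017, §7.4.2 (p. 31)] [cite: PastenShimura2024, Prop. 6.13, Lemma 6.18] [cite: SilvermanAEC2009, VII.5 Prop. 5.1] [cite: Cremona2006, Table 1 (Cremona label 334170br1)] -/
theorem u0_at_334170br1
    (hGZK : rank_eq_analyticRank_of_analyticRank_le_one) (hmod : hasEntireLFunction_rat)
    (hnf : exists_isNewformOf) (hJL : nonempty_shimuraParametrizationData)
    (hCO : PastenShimura2024_componentOrders)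
    (hHK : shimuraCurve_heegnerPoint_grossZagier_kolyvagin)
    {W : WeierstrassCurve ℚ} [W.IsElliptic] [W.IsGloballyMinimal] (hWeq : W = (⟨1, -1, 1, -196922, -33585479⟩ : WeierstrassCurve ℚ))
    (hN : W.conductorNorm ℤ = 334170) [NeZero (W.conductorNorm ℤ)] (hr : W.analyticRank = 0)
    (Dt : ModularParametrizationData W (W.conductorNorm ℤ)) (hc : ¬ (3 : ℤ) ∣ Dt.c)
    (hLt0 : (W.quadraticTwist (((-107 : ℤ) : ℚ))).entireLFunction 1 = 0)
    (hLt1 : deriv (W.quadraticTwist (((-107 : ℤ) : ℚ))).entireLFunction 1 ≠ 0)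
    {qd : ℚ} (hqd : haveI := isElliptic_sWd334170br1; shaAn (⟨1, -1, 0, -2254556400, 41204528648000⟩ : WeierstrassCurve ℚ) = (qd : ℂ))
    (hvd : padicValRat 3 qd ≤ 0) :
    MissingUpperBoundAt W 3 := by
  subst hWeq
  haveI := isElliptic_sWd334170br1; haveI := isGloballyMinimal_sWd334170br1
  have hI : integralModelInt (⟨1, -1, 1, -196922, -33585479⟩ : WeierstrassCurve ℚ) = (⟨1, -1, 1, -196922, -33585479⟩ : WeierstrassCurve ℤ) :=
    integralModelInt_eq_of_map_eq _ (map_mk_int 1 (-1) 1 (-196922) (-33585479))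
  have hGS := subGss_three_334170br1 (W := (⟨1, -1, 1, -196922, -33585479⟩ : WeierstrassCurve ℚ)) rfl
  have hs₁ : haveI : Fact (Nat.Prime 2) := ⟨by norm_num⟩; (⟨1, -1, 1, -196922, -33585479⟩ : WeierstrassCurve ℚ).HasSplitMultiplicativeReductionAtPrime 2 := by
    refine IntModel.hasSplitMultiplicativeReductionAtPrime_of_intModel_of_root (hp := ⟨by norm_num⟩) hI 2 (by rw [Δ_eq_334170br1]; norm_num) (by rw [c₄_eq_334170br1]; norm_num) ⟨0, ?_⟩
    simp only [WeierstrassCurve.c₄, WeierstrassCurve.b₂, WeierstrassCurve.b₄, WeierstrassCurve.b₆]; push_cast; decide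
  have hs₂ : haveI : Fact (Nat.Prime 5) := ⟨by norm_num⟩; (⟨1, -1, 1, -196922, -33585479⟩ : WeierstrassCurve ℚ).HasSplitMultiplicativeReductionAtPrime 5 := by
    refine IntModel.hasSplitMultiplicativeReductionAtPrime_of_intModel_of_root (hp := ⟨by norm_num⟩) hI 5 (by rw [Δ_eq_334170br1]; norm_num) (by rw [c₄_eq_334170br1]; norm_num) ⟨1, ?_⟩
    simp only [WeierstrassCurve.c₄, WeierstrassCurve.b₂, WeierstrassCurve.b₄, WeierstrassCurve.b₆]; push_cast; decide
  haveI : Fact ((-107 : ℤ) < 0) := ⟨by norm_num⟩; haveI : Fact (Nat.Prime 2) := ⟨by norm_num⟩; haveI : Fact (Nat.Prime 5) := ⟨by norm_num⟩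
  have hothers : ∀ (ℓ : ℕ) [Fact ℓ.Prime], ℓ ≠ 2 → ℓ ≠ 5 → (⟨1, -1, 1, -196922, -33585479⟩ : WeierstrassCurve ℚ).HasSplitMultiplicativeReductionAtPrime ℓ →
      ¬ 3 ∣ padicValInt ℓ (⟨1, -1, 1, -196922, -33585479⟩ : WeierstrassCurve ℚ).minimalDiscriminantInt := by
    intro ℓ hℓF hne₁ hne₂ hs
    have hd := dvd_minimalDiscriminantInt_of_mult _ ℓ hs.hasMultiplicativeReductionAtPrime
    rw [IntModel.minimalDiscriminantInt_eq hI, Δ_eq_334170br1] at hd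
    have hmem := mem_of_prime_dvd_of_prodPow_eq _ krausList_334170br1 hℓF.out hd
    simp only [List.map_cons, List.map_nil, List.mem_cons, List.not_mem_nil, or_false] at hmem
    rcases hmem with rfl | rfl | rfl | rfl | rfl
    · exact absurd rfl hne₁
    · exact absurd hs.hasMultiplicativeReductionAtPrime (X9.PrintCert.not_hasMultiplicativeReductionAtPrime_of_dvd_of_dvd hI 3 (by rw [Δ_eq_334170br1]; norm_num) (by rw [c₄_eq_334170br1]; norm_num))
    · exact absurd rfl hne₂
    · rw [IntModel.minimalDiscriminantInt_eq hI, Δ_eq_334170br1, IntModel.padicValInt_eq_of_dvd_of_not_dvd 47 (e := 1) (by norm_num) (by norm_num)]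
      decide
    · rw [IntModel.minimalDiscriminantInt_eq hI, Δ_eq_334170br1, IntModel.padicValInt_eq_of_dvd_of_not_dvd 79 (e := 2) (by norm_num) (by norm_num)]
      decide
  have hshape : ∀ (q : ℕ) [Fact q.Prime], 3 ∣ ((⟨1, -1, 1, -196922, -33585479⟩ : WeierstrassCurve ℚ).baseChange ℚ_[q]).localTamagawaNumber ℤ_[q] →
      (⟨1, -1, 1, -196922, -33585479⟩ : WeierstrassCurve ℚ).HasSplitMultiplicativeReductionAtPrime q := by
    intro q hqF h3
    by_cases hd : (q : ℤ) ∣ minimalDiscriminantInt (⟨1, -1, 1, -196922, -33585479⟩ : WeierstrassCurve ℚ)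
    swap
    · exact absurd h3 (not_three_dvd_localTamagawaNumber_of_not_dvd _ q hd)
    rw [IntModel.minimalDiscriminantInt_eq hI, Δ_eq_334170br1] at hd
    have hmem := mem_of_prime_dvd_of_prodPow_eq _ krausList_334170br1 hqF.out hd
    simp only [List.map_cons, List.map_nil, List.mem_cons, List.not_mem_nil, or_false] at hmem
    rcases hmem with rfl | rfl | rfl | rfl | rfl
    · exact hs₁
    · have hc3 : ((⟨1, -1, 1, -196922, -33585479⟩ : WeierstrassCurve ℚ).baseChange ℚ_[3]).localTamagawaNumber ℤ_[3] = 1 := -- additive `3` (I0*): Tate certificate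
        (IntModelTam.localTamagawaNumber_padic_eq_of_intModel_of_tamZ hI 3 (F := ⟨3, 9, 1, 1, 8, 6, 0, 0⟩) rfl (by decide +kernel)).trans (by decide)
      rw [hc3] at h3; exact absurd h3 (by decide)
    · exact hs₂
    · exact (Koly.split_and_three_dvd_of_mult_of_three_dvd_localTamagawaNumber _ 47 (IntModel.hasMultiplicativeReductionAtPrime_of_intModel hI 47 (by rw [Δ_eq_334170br1]; norm_num) (by rw [c₄_eq_334170br1]; norm_num)) h3).1
    · exact (Koly.split_and_three_dvd_of_mult_of_three_dvd_localTamagawaNumber _ 79 (IntModel.hasMultiplicativeReductionAtPrime_of_intModel hI 79 (by rw [Δ_eq_334170br1]; norm_num) (by rw [c₄_eq_334170br1]; norm_num)) h3).1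
  have hjac : ∀ ℓ : ℕ, ℓ.Prime → ℓ ∣ (⟨1, -1, 1, -196922, -33585479⟩ : WeierstrassCurve ℚ).conductorNorm ℤ → ℓ ≠ 2 → ℓ ≠ 5 → ℓ ≠ 2 →
      jacobiSym (-107) ℓ = 1 := by
    intro ℓ hℓ hℓN hne₁ hne₂ hℓ2
    rw [hN] at hℓN
    have hmem : ℓ ∈ Nat.primeFactors 334170 := Nat.mem_primeFactors.mpr ⟨hℓ, hℓN, by norm_num⟩
    rw [show Nat.primeFactors 334170 = {2, 3, 5, 47, 79} by decide +kernel] at hmem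
    simp only [Finset.mem_insert, Finset.mem_singleton] at hmem
    rcases hmem with rfl | rfl | rfl | rfl | rfl
    · exact absurd rfl hne₁
    · norm_num [jacobiSym.mod_left]
    · exact absurd rfl hne₂
    · norm_num [jacobiSym.mod_left]
    · norm_num [jacobiSym.mod_left]
  have hWd : (⟨1, (-27 : ℚ), ((1:ℚ)/2), (0 : ℚ)⟩ : VariableChange ℚ) • (⟨1, -1, 1, -196922, -33585479⟩ : WeierstrassCurve ℚ).quadraticTwist (((-107 : ℤ) : ℚ)) =
      (⟨1, -1, 0, -2254556400, 41204528648000⟩ : WeierstrassCurve ℚ) := by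
    push_cast; ext <;> simp [WeierstrassCurve.variableChange_a₁, WeierstrassCurve.variableChange_a₂,
      WeierstrassCurve.variableChange_a₃, WeierstrassCurve.variableChange_a₄, WeierstrassCurve.variableChange_a₆,
      WeierstrassCurve.quadraticTwist, WeierstrassCurve.b₂, WeierstrassCurve.b₄, WeierstrassCurve.b₆] <;> norm_num
  exact leafRankZeroUpper_three_of_twoCarriers_of_sqrtField hGZK hmod hnf hJL hCO hHK _ hGS.1 hGS.2 hr rfl Dt hc
    (q₁ := 2) (q₂ := 5) (by decide) hs₁ hs₂ hothers hshape (by decide) (by decide)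
    (-107) (by norm_num)
    (by rw [show (-107 : ℤ).natAbs = 107 by rfl, Nat.squarefree_iff_nodup_primeFactorsList (by norm_num)]; simp)
    (Or.inl ⟨rfl, by norm_num⟩) (by norm_num) (by norm_num [jacobiSym.mod_left]) (by norm_num) hjac
    (fun _ h ↦ absurd rfl h) hLt0 hLt1 _ _ hWd hqd hvd

/-! ## §20 `336114l1` = `[1, -1, 1, -17777, -1391327]`, `N = 336114 = 2·3^2·71·263` (`2`: I9, `c = 9`, split, `3`: I₀*, `c = 1`, `71`: I1, `c = 1`, non-split, `263`: I3, `c = 3`, split); carriers `S = {2, 263}` (split, `3 ∣ ord Δ`), (DEG) by Papikian–Rabinoff at `q₂ = 263` (odd, `≡ 2 (mod 3)`);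
`r_an = 0`, `#E(ℚ)_tors = 1`, `∏ c_ℓ = 27`, `#Ш(E)_an = 1` (Cremona/LMFDB, displayed where used); class `336114l` of size 1.
`V = E^{(-3)}_min = [1, -1, 0, -1975, 52189]` (`#Ṽ(𝔽₃) = 7`).  JSW field `K = ℚ(√-11)` (`11` prime; `2`, `263` inert, every other `ℓ ∣ N` split): the least such `D` (among those tried) with a CERTIFIED twist unit
(kit j318499: root no. `−1`, `L′(Wd,1) = 6.923986`, `Wd = E^{(-11)}_min = [1, -1, 0, -2150979, 1858308821]`, `N(Wd) = 40669794`, `∏c = 2`, `T = 1`, point by `ellrank(effort=0)`, eclib-full saturation (index 1), `ĥ = 23.825208`,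
`X = L′T²/(Ω∏c ĥ) = 1` to `1e-16` — the numerical `#Ш(Wd)_an` given rank `1`). -/

/-- `V = [1, -1, 0, -1975, 52189]` (the minimal model of `336114l1^{(-3)}`, conductor `37346`): `Δ ≠ 0` in the kernel. [cite: Cremona2006, Table 1 (Cremona label 336114l1)] -/
theorem isElliptic_sV336114l1 : (⟨1, -1, 0, -1975, 52189⟩ : WeierstrassCurve ℚ).IsElliptic :=
  isElliptic_of_discOf_ne_zero 1 (-1) 0 (-1975) 52189 (by decide +kernel)

/-- `V` is globally minimal: `|Δ| = 2^9·71·263^3` kernel-checked, Kraus' criterion prime by prime. [cite: Kraus1989, Prop. 1 and Prop. 2]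
[cite: SilvermanAEC2009, VII.1 Remark 1.1] [cite: Cremona2006, Table 1 (Cremona label 336114l1)] -/
theorem isGloballyMinimal_sV336114l1 : (⟨1, -1, 0, -1975, 52189⟩ : WeierstrassCurve ℚ).IsGloballyMinimal :=
  isGloballyMinimal_of_krausCriterion₃_factored 1 (-1) 0 (-1975) 52189
    [(2, 9), (71, 1), (263, 3)] (by decide +kernel)
    (by intro qe hqe; simp only [List.mem_cons, List.not_mem_nil, or_false] at hqe
        rcases hqe with rfl | rfl | rfl <;> norm_num)
    (by set_option synthInstance.maxSize 2000 in decide +kernel)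

/-- `Wd = [1, -1, 0, -2150979, 1858308821]` (the minimal model of the twist `336114l1^{(-11)}`, conductor `40669794`): `Δ ≠ 0` in the kernel. [cite: Cremona2006, Table 1 (Cremona label 336114l1)] -/
theorem isElliptic_sWd336114l1 : (⟨1, -1, 0, -2150979, 1858308821⟩ : WeierstrassCurve ℚ).IsElliptic :=
  isElliptic_of_discOf_ne_zero 1 (-1) 0 (-2150979) 1858308821 (by decide +kernel)

/-- `Wd` is globally minimal: `|Δ| = 2^9·3^6·11^6·71·263^3` kernel-checked, Kraus' criterion prime by prime. [cite: Kraus1989, Prop. 1 and Prop. 2]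
[cite: SilvermanAEC2009, VII.1 Remark 1.1] [cite: Cremona2006, Table 1 (Cremona label 336114l1)] -/
theorem isGloballyMinimal_sWd336114l1 : (⟨1, -1, 0, -2150979, 1858308821⟩ : WeierstrassCurve ℚ).IsGloballyMinimal :=
  isGloballyMinimal_of_krausCriterion₃_factored 1 (-1) 0 (-2150979) 1858308821
    [(2, 9), (3, 6), (11, 6), (71, 1), (263, 3)] (by decide +kernel)
    (by intro qe hqe; simp only [List.mem_cons, List.not_mem_nil, or_false] at hqe
        rcases hqe with rfl | rfl | rfl | rfl | rfl <;> norm_num)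
    (by set_option synthInstance.maxSize 2000 in decide +kernel)

/-- **`336114l1` is ADDITIVE at `3` and on the cell (G) ∧ ss, IN THE KERNEL**: `3 ∣ Δ`, `3 ∣ c₄`; `C • V^{(-3)} = E` (`[u, r, s, t] = [1, -1, 1/2, 1/2]`) with
`V` globally minimal, `3 ∤ Δ(V)`, `#Ṽ(𝔽₃) = 7` (`a₃(V) = -3`, supersingular), whence `TypeG`, `SubGord`, `SubGss` at `3` (g13's block, unchanged).
[cite: SilvermanAEC2009, VII.5 Prop. 5.1 (a), (c)] [cite: Delbourgo1998, §1.5 (G)] [cite: Cremona2006, Table 1 (Cremona label 336114l1)] -/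
theorem subGss_three_336114l1 {W : WeierstrassCurve ℚ} [W.IsElliptic] [W.IsGloballyMinimal] (hWeq : W = (⟨1, -1, 1, -17777, -1391327⟩ : WeierstrassCurve ℚ)) :
    Addv W 3 ∧ SubGss W 3 := by
  subst hWeq
  haveI := isElliptic_sV336114l1
  haveI := isGloballyMinimal_sV336114l1
  have hIW : integralModelInt (⟨1, -1, 1, -17777, -1391327⟩ : WeierstrassCurve ℚ) = (⟨1, -1, 1, -17777, -1391327⟩ : WeierstrassCurve ℤ) :=
    integralModelInt_eq_of_map_eq _ (map_mk_int 1 (-1) 1 (-17777) (-1391327))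
  have hadd : Addv (⟨1, -1, 1, -17777, -1391327⟩ : WeierstrassCurve ℚ) 3 := Additive.addv_of_intModel hIW 3 (by decide +kernel) (by decide +kernel)
  have hIV : integralModelInt (⟨1, -1, 0, -1975, 52189⟩ : WeierstrassCurve ℚ) = (⟨1, -1, 0, -1975, 52189⟩ : WeierstrassCurve ℤ) :=
    integralModelInt_eq_of_map_eq _ (map_mk_int 1 (-1) 0 (-1975) 52189)
  have hcV : Nat.card ((((⟨1, -1, 0, -1975, 52189⟩ : WeierstrassCurve ℤ)).map (Int.castRingHom (ZMod 3))).toAffine.Point) = 7 := by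
    have h := natCard_point_eq_countPoints 1 (-1) 0 (-1975) 52189 3 (by norm_num) (by decide +kernel)
    have h' : countPoints [1, -1, 0, -1975, 52189] 3 = 7 := countPoints_eq_of_fast (by decide +kernel)
    exact_mod_cast h.trans h'
  have hgood : GoodSS (⟨1, -1, 0, -1975, 52189⟩ : WeierstrassCurve ℚ) 3 := Supersingular.goodSS_of_intModel 3 hIV (by decide +kernel) hcV (by decide)
  have hVW : (⟨1, (-1 : ℚ), ((1:ℚ)/2), ((1:ℚ)/2)⟩ : VariableChange ℚ) • (⟨1, -1, 0, -1975, 52189⟩ : WeierstrassCurve ℚ).quadraticTwist (-3) =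
      (⟨1, -1, 1, -17777, -1391327⟩ : WeierstrassCurve ℚ) := by
    ext <;> simp [WeierstrassCurve.variableChange_a₁, WeierstrassCurve.variableChange_a₂,
      WeierstrassCurve.variableChange_a₃, WeierstrassCurve.variableChange_a₄, WeierstrassCurve.variableChange_a₆,
      WeierstrassCurve.quadraticTwist, WeierstrassCurve.b₂, WeierstrassCurve.b₄, WeierstrassCurve.b₆] <;> norm_num
  obtain ⟨C, hC⟩ := exists_variableChange_quadraticTwist_symm (⟨1, -1, 1, -17777, -1391327⟩ : WeierstrassCurve ℚ)
    (⟨1, -1, 0, -1975, 52189⟩ : WeierstrassCurve ℚ) (d := (-3 : ℚ)) (by norm_num) ⟨_, hVW⟩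
  have hC' : C • (⟨1, -1, 1, -17777, -1391327⟩ : WeierstrassCurve ℚ).quadraticTwist ((-1 : ℚ) ^ ((3 : ℕ) / 2) * (3 : ℕ)) =
      (⟨1, -1, 0, -1975, 52189⟩ : WeierstrassCurve ℚ) := by
    rw [O5.pstar_three]; exact hC
  have hG : TypeG (⟨1, -1, 1, -17777, -1391327⟩ : WeierstrassCurve ℚ) 3 := (typeG_three_iff_good_twist _ hadd _ C hC').mpr hgood.1
  exact ⟨hadd, (O5.subGss_three_iff_subGord_and_goodSS_twist _ hadd _ C hC).mpr
    ⟨subGord_three_of_typeG_of_addv _ hG hadd, hgood⟩⟩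

/-- `Δ(E₀) = -482084405899776 = -2^9·3^6·71·263^3` on the integer equation of `336114l1`. [cite: Cremona2006, Table 1 (Cremona label 336114l1)] -/
theorem Δ_eq_336114l1 : (⟨1, -1, 1, -17777, -1391327⟩ : WeierstrassCurve ℤ).Δ = -482084405899776 := by
  norm_num [WeierstrassCurve.Δ, WeierstrassCurve.b₂, WeierstrassCurve.b₄, WeierstrassCurve.b₆, WeierstrassCurve.b₈]

/-- `c₄(E₀) = 853281` on the integer equation of `336114l1`. [cite: Cremona2006, Table 1 (Cremona label 336114l1)] -/
theorem c₄_eq_336114l1 : (⟨1, -1, 1, -17777, -1391327⟩ : WeierstrassCurve ℤ).c₄ = 853281 := by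
  norm_num [WeierstrassCurve.c₄, WeierstrassCurve.b₂, WeierstrassCurve.b₄]

/-- The Kraus list of `336114l1` consists of primes and multiplies to `|Δ(E₀)|`, IN THE KERNEL: a prime dividing `Δ_min` is one of `[2, 3, 71, 263]`. [cite: Cremona2006, Table 1 (Cremona label 336114l1)] -/
theorem krausList_336114l1 : (∀ qe ∈ ([(2, 9), (3, 6), (71, 1), (263, 3)] : List (ℕ × ℕ)), qe.1.Prime) ∧
    (([(2, 9), (3, 6), (71, 1), (263, 3)] : List (ℕ × ℕ)).map fun qe => qe.1 ^ qe.2).prod = (-482084405899776 : ℤ).natAbs :=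
  ⟨by decide +kernel, by decide +kernel⟩

/-- **U₀ AT `336114l1` BY THE INERT-CARRIER (Shimura-curve) ROAD, TU₀|inert** — `MissingUpperBoundAt W 3` at `W = E` (`r_an = 0`) from rhp-p2 g10's certificate shape
p662479 `leafRankZeroUpper_three_of_shimuraInertDatum_of_twistUnitZero` (Papikian–Rabinoff (DEG) at the odd carrier) through the §0 door `leafRankOneUpper_three_of_twoCarriers_of_sqrtField` of part one.  PRINTED: `hGZK hmod hnf hJL hCO hHK`.  KERNEL: `Addv ∧ SubGss` at `3`;
`2`, `263` split (nodal roots `0`, `90`); every prime of `Δ_min` enumerated (`krausList_336114l1`) for `hothers` and `hshape` (`c = 1` off `Δ_min`, Kodaira–Néron at the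
multiplicative primes, Tate certificates at the additive primes `[3]`); the congruences making `2`, `263` inert and the other `ℓ ∣ N` split in `ℚ(√-11)`; the twist
identity `Cd • E^{(-11)} = Wd`, `Cd = [1, -3, 1/2, 0]`, with `Wd` Kraus-minimal.  DISPLAYED: `hN`, `hr` (`r_an = 0`), `Dt`/`hc` (`3 ∤ c(Dt)`), `hLt0`/`hLt1` (`L(E^{(-11)},1) = 0 ≠ L′(E^{(-11)},1)`; census: root number `−1`, `L′(Wd,1) ≈ 6.923986`),
`hqd`/`hvd` (`#Ш(Wd)_an = 1`; census: `X = L′·T²/(Ω·∏c·ĥ(P)) = 1` to `1.1e-16` at the eclib-full-saturated point `P` of height `23.825208` found by `ellrank(effort=0)`).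
NO ¬CM / S2 / Σ / L₀ / L₁.  Per curve; U₀ (26024) stays OPEN class-wide; BSD is NOT proved by this.
[cite: JetchevSkinnerWan2017, §7.4.2 (p. 31)] [cite: PastenShimura2024, Prop. 6.13, Lemma 6.18] [cite: SilvermanAEC2009, VII.5 Prop. 5.1] [cite: Cremona2006, Table 1 (Cremona label 336114l1)] -/
theorem u0_at_336114l1
    (hGZK : rank_eq_analyticRank_of_analyticRank_le_one) (hmod : hasEntireLFunction_rat)
    (hnf : exists_isNewformOf) (hJL : nonempty_shimuraParametrizationData)
    (hCO : PastenShimura2024_componentOrders)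
    (hHK : shimuraCurve_heegnerPoint_grossZagier_kolyvagin)
    {W : WeierstrassCurve ℚ} [W.IsElliptic] [W.IsGloballyMinimal] (hWeq : W = (⟨1, -1, 1, -17777, -1391327⟩ : WeierstrassCurve ℚ))
    (hN : W.conductorNorm ℤ = 336114) [NeZero (W.conductorNorm ℤ)] (hr : W.analyticRank = 0)
    (Dt : ModularParametrizationData W (W.conductorNorm ℤ)) (hc : ¬ (3 : ℤ) ∣ Dt.c)
    (hLt0 : (W.quadraticTwist (((-11 : ℤ) : ℚ))).entireLFunction 1 = 0)
    (hLt1 : deriv (W.quadraticTwist (((-11 : ℤ) : ℚ))).entireLFunction 1 ≠ 0)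
    {qd : ℚ} (hqd : haveI := isElliptic_sWd336114l1; shaAn (⟨1, -1, 0, -2150979, 1858308821⟩ : WeierstrassCurve ℚ) = (qd : ℂ))
    (hvd : padicValRat 3 qd ≤ 0) :
    MissingUpperBoundAt W 3 := by
  subst hWeq
  haveI := isElliptic_sWd336114l1; haveI := isGloballyMinimal_sWd336114l1
  have hI : integralModelInt (⟨1, -1, 1, -17777, -1391327⟩ : WeierstrassCurve ℚ) = (⟨1, -1, 1, -17777, -1391327⟩ : WeierstrassCurve ℤ) :=
    integralModelInt_eq_of_map_eq _ (map_mk_int 1 (-1) 1 (-17777) (-1391327))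
  have hGS := subGss_three_336114l1 (W := (⟨1, -1, 1, -17777, -1391327⟩ : WeierstrassCurve ℚ)) rfl
  have hs₁ : haveI : Fact (Nat.Prime 2) := ⟨by norm_num⟩; (⟨1, -1, 1, -17777, -1391327⟩ : WeierstrassCurve ℚ).HasSplitMultiplicativeReductionAtPrime 2 := by
    refine IntModel.hasSplitMultiplicativeReductionAtPrime_of_intModel_of_root (hp := ⟨by norm_num⟩) hI 2 (by rw [Δ_eq_336114l1]; norm_num) (by rw [c₄_eq_336114l1]; norm_num) ⟨0, ?_⟩
    simp only [WeierstrassCurve.c₄, WeierstrassCurve.b₂, WeierstrassCurve.b₄, WeierstrassCurve.b₆]; push_cast; decide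
  have hs₂ : haveI : Fact (Nat.Prime 263) := ⟨by norm_num⟩; (⟨1, -1, 1, -17777, -1391327⟩ : WeierstrassCurve ℚ).HasSplitMultiplicativeReductionAtPrime 263 := by
    refine IntModel.hasSplitMultiplicativeReductionAtPrime_of_intModel_of_root (hp := ⟨by norm_num⟩) hI 263 (by rw [Δ_eq_336114l1]; norm_num) (by rw [c₄_eq_336114l1]; norm_num) ⟨90, ?_⟩
    simp only [WeierstrassCurve.c₄, WeierstrassCurve.b₂, WeierstrassCurve.b₄, WeierstrassCurve.b₆]; push_cast; decide
  haveI : Fact ((-11 : ℤ) < 0) := ⟨by norm_num⟩; haveI : Fact (Nat.Prime 2) := ⟨by norm_num⟩; haveI : Fact (Nat.Prime 263) := ⟨by norm_num⟩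
  have hothers : ∀ (ℓ : ℕ) [Fact ℓ.Prime], ℓ ≠ 2 → ℓ ≠ 263 → (⟨1, -1, 1, -17777, -1391327⟩ : WeierstrassCurve ℚ).HasSplitMultiplicativeReductionAtPrime ℓ →
      ¬ 3 ∣ padicValInt ℓ (⟨1, -1, 1, -17777, -1391327⟩ : WeierstrassCurve ℚ).minimalDiscriminantInt := by
    intro ℓ hℓF hne₁ hne₂ hs
    have hd := dvd_minimalDiscriminantInt_of_mult _ ℓ hs.hasMultiplicativeReductionAtPrime
    rw [IntModel.minimalDiscriminantInt_eq hI, Δ_eq_336114l1] at hd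
    have hmem := mem_of_prime_dvd_of_prodPow_eq _ krausList_336114l1 hℓF.out hd
    simp only [List.map_cons, List.map_nil, List.mem_cons, List.not_mem_nil, or_false] at hmem
    rcases hmem with rfl | rfl | rfl | rfl
    · exact absurd rfl hne₁
    · exact absurd hs.hasMultiplicativeReductionAtPrime (X9.PrintCert.not_hasMultiplicativeReductionAtPrime_of_dvd_of_dvd hI 3 (by rw [Δ_eq_336114l1]; norm_num) (by rw [c₄_eq_336114l1]; norm_num))
    · rw [IntModel.minimalDiscriminantInt_eq hI, Δ_eq_336114l1, IntModel.padicValInt_eq_of_dvd_of_not_dvd 71 (e := 1) (by norm_num) (by norm_num)]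
      decide
    · exact absurd rfl hne₂
  have hshape : ∀ (q : ℕ) [Fact q.Prime], 3 ∣ ((⟨1, -1, 1, -17777, -1391327⟩ : WeierstrassCurve ℚ).baseChange ℚ_[q]).localTamagawaNumber ℤ_[q] →
      (⟨1, -1, 1, -17777, -1391327⟩ : WeierstrassCurve ℚ).HasSplitMultiplicativeReductionAtPrime q := by
    intro q hqF h3
    by_cases hd : (q : ℤ) ∣ minimalDiscriminantInt (⟨1, -1, 1, -17777, -1391327⟩ : WeierstrassCurve ℚ)
    swap
    · exact absurd h3 (not_three_dvd_localTamagawaNumber_of_not_dvd _ q hd)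
    rw [IntModel.minimalDiscriminantInt_eq hI, Δ_eq_336114l1] at hd
    have hmem := mem_of_prime_dvd_of_prodPow_eq _ krausList_336114l1 hqF.out hd
    simp only [List.map_cons, List.map_nil, List.mem_cons, List.not_mem_nil, or_false] at hmem
    rcases hmem with rfl | rfl | rfl | rfl
    · exact hs₁
    · have hc3 : ((⟨1, -1, 1, -17777, -1391327⟩ : WeierstrassCurve ℚ).baseChange ℚ_[3]).localTamagawaNumber ℤ_[3] = 1 := -- additive `3` (I0*): Tate certificate
        (IntModelTam.localTamagawaNumber_padic_eq_of_intModel_of_tamZ hI 3 (F := ⟨3, 9, 1, 1, 8, 6, 0, 0⟩) rfl (by decide +kernel)).trans (by decide)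
      rw [hc3] at h3; exact absurd h3 (by decide)
    · exact (Koly.split_and_three_dvd_of_mult_of_three_dvd_localTamagawaNumber _ 71 (IntModel.hasMultiplicativeReductionAtPrime_of_intModel hI 71 (by rw [Δ_eq_336114l1]; norm_num) (by rw [c₄_eq_336114l1]; norm_num)) h3).1
    · exact hs₂
  have hjac : ∀ ℓ : ℕ, ℓ.Prime → ℓ ∣ (⟨1, -1, 1, -17777, -1391327⟩ : WeierstrassCurve ℚ).conductorNorm ℤ → ℓ ≠ 2 → ℓ ≠ 263 → ℓ ≠ 2 →
      jacobiSym (-11) ℓ = 1 := by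
    intro ℓ hℓ hℓN hne₁ hne₂ hℓ2
    rw [hN] at hℓN
    have hmem : ℓ ∈ Nat.primeFactors 336114 := Nat.mem_primeFactors.mpr ⟨hℓ, hℓN, by norm_num⟩
    rw [show Nat.primeFactors 336114 = {2, 3, 71, 263} by decide +kernel] at hmem
    simp only [Finset.mem_insert, Finset.mem_singleton] at hmem
    rcases hmem with rfl | rfl | rfl | rfl
    · exact absurd rfl hne₁
    · norm_num [jacobiSym.mod_left]
    · norm_num [jacobiSym.mod_left]
    · exact absurd rfl hne₂
  have hWd : (⟨1, (-3 : ℚ), ((1:ℚ)/2), (0 : ℚ)⟩ : VariableChange ℚ) • (⟨1, -1, 1, -17777, -1391327⟩ : WeierstrassCurve ℚ).quadraticTwist (((-11 : ℤ) : ℚ)) =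
      (⟨1, -1, 0, -2150979, 1858308821⟩ : WeierstrassCurve ℚ) := by
    push_cast; ext <;> simp [WeierstrassCurve.variableChange_a₁, WeierstrassCurve.variableChange_a₂,
      WeierstrassCurve.variableChange_a₃, WeierstrassCurve.variableChange_a₄, WeierstrassCurve.variableChange_a₆,
      WeierstrassCurve.quadraticTwist, WeierstrassCurve.b₂, WeierstrassCurve.b₄, WeierstrassCurve.b₆] <;> norm_num
  exact leafRankZeroUpper_three_of_twoCarriers_of_sqrtField hGZK hmod hnf hJL hCO hHK _ hGS.1 hGS.2 hr rfl Dt hc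
    (q₁ := 2) (q₂ := 263) (by decide) hs₁ hs₂ hothers hshape (by decide) (by decide)
    (-11) (by norm_num)
    (by rw [show (-11 : ℤ).natAbs = 11 by rfl, Nat.squarefree_iff_nodup_primeFactorsList (by norm_num)]; simp)
    (Or.inl ⟨rfl, by norm_num⟩) (by norm_num) (by norm_num [jacobiSym.mod_left]) (by norm_num) hjac
    (fun _ h ↦ absurd rfl h) hLt0 hLt1 _ _ hWd hqd hvd

end Summit.BirchSwinnertonDyer.BirchSwinnertonDyer.Theorems.RamifiedHeegnerPairTwistUnitInertZero

end
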